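import Summits.Ventures.ResidMod.Mod3SurjectiveVerdict
import HarnessLib

/-!
# Venture ResidMod — the MOD-3 flag (surjective image): the verdict with FLAT slots, F2OK decided from
# `L₂(A,T)` in the kernel

HONEST FRAMING. Interface file of a COMPUTATION cell (`pub-residmod`); companion of
`Mod3SurjectiveVerdict.lean`. NO surface is claimed modular; every datum is a binder; the cited theorem
is the tree's named fact `bcgp2025_modThreeSurjective_modular_abelianSurface` (BCGP 2025 Thm. 1.1.1),
hypothesis `h111`. This is the shape the per-surface instance files use: instead of the structure
`Mod3SurjectiveCertificate` (whose field `card_range` cannot be turned into surjectivity inside the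
tree), the slots are passed flat —
* TORS3: `ρb` with a contragredient torsion frame of `A[3]` (MODELLING BINDER: "`ρb` is `ρ̄_{A,3}`");
* POL ∧ SURJ(3): `hsurj`, in the fact's own shape (a non-degenerate alternating `J`, `ρb` symplectic with
  multiplier `ε̄⁻¹`, every similitude of `J` a value of `ρb`) — the offline checker's verdict SURJECTIVE;
* UNRAM2(3): `hunr` (binder; good reduction at `2`);
* `L₂(A,T) = 1 − a₂T + b₂T² − 2a₂T³ + 4T⁴` (`HasGoodEulerFactorAt 2`) with the NUMERIC condition
  `¬ (b₂ ≡ 2 ∧ a₂ ≢ 0 mod 3)` — from which F2OK is DERIVED (`frobCharpoly_two_ne_of_eulerData`);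
* GOOD ∧ ORD(3): `hord3` (binder, `HasGoodOrdinaryReductionAt`);
* `L₃(A,T)` (`HasGoodEulerFactorAt 3`) and its separability over `ℚ` (DIST0(3); a Bézout identity checked
  by `ring`, `InstanceKit.separable_of_intBezout`) — from which (3b) is DERIVED (bridge B3).

References: [BoxerCalegariGeePilloni2025] arXiv:2502.20645 Thm. 1.1.1, Lemma 9.1.3, Def. 9.1.2, §1.8.
-/

noncomputable section

namespace Summit.Ventures.ResidMod

open CategoryTheory IsDedekindDomain Field Polynomial Matrix
open scoped NumberField
open Literature.NumberTheory.GaloisRepresentations Literature.NumberTheory.Automorphic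
open Literature.NumberTheory.Automorphic.Paramodular
open Literature.NumberTheory.DiophantineGeometry Literature.NumberTheory.FaltingsSerre
open Literature.AlgebraicGeometry.Motives (AbelianVariety)

/-- **VERDICT (mod-3 flag, surjective image) with flat slots, GIVEN BCGP 2025 Thm. 1.1.1.**  See the
module docstring for the slot list; F2OK is decided in the kernel from `(a₂, b₂) mod 3`, (3b) from the
separability of `L₃(A,T)`. Conclusion: every framed dual of every `V_p(A)` is `IsAutomorphicAE`.
CONDITIONAL on `h111` (the named fact); every datum a binder. [cite: BoxerCalegariGeePilloni2025, Thm. 1.1.1; Lemma 9.1.3; §1.8] -/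
theorem modular_of_mod3Slots_of_bcgp2025
    (h111 : bcgp2025_modThreeSurjective_modular_abelianSurface)
    (A : AbelianVariety ℚ) (hA : A.dim = 2) (ρb : FramedGaloisRep ℚ (ZMod 3) 4)
    (hframe : ∃ e₃ : A.geomTorsion (3 : ℕ) ≃+ (Fin 4 → ZMod 3),
      ∀ (g : absoluteGaloisGroup ℚ) (P : A.geomTorsion (3 : ℕ)),
        e₃ (g • P) = ((ρb g⁻¹ : GL (Fin 4) (ZMod 3)) : Matrix (Fin 4) (Fin 4) (ZMod 3))ᵀ *ᵥ e₃ P)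
    (hsurj : ∃ J : Matrix (Fin 4) (Fin 4) (ZMod 3), Jᵀ = -J ∧ IsUnit J.det ∧
      (∀ σ : absoluteGaloisGroup ℚ,
        (ρb σ).valᵀ * J * (ρb σ).val =
          (((modPCyclotomicCharacterZMod ℚ 3 σ)⁻¹ : (ZMod 3)ˣ) : ZMod 3) • J) ∧
      ∀ M : Matrix (Fin 4) (Fin 4) (ZMod 3),
        (∃ c : (ZMod 3)ˣ, Mᵀ * J * M = (c : ZMod 3) • J) →
          ∃ σ : absoluteGaloisGroup ℚ, (ρb σ).val = M)
    (hunr : ∀ v : HeightOneSpectrum (𝓞 ℚ), ((2 : ℕ) : 𝓞 ℚ) ∈ v.asIdeal → ρb.IsUnramifiedAt v)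
    {a₂ b₂ : ℤ} (hL2 : A.HasGoodEulerFactorAt 2 ((lPolynomialOfSurface 2 a₂ b₂).map (Int.castRingHom ℚ)))
    (hab : ¬ (((b₂ : ℤ) : ZMod 3) = 2 ∧ ((a₂ : ℤ) : ZMod 3) ≠ 0))
    (hord3 : ∀ v : HeightOneSpectrum (𝓞 ℚ), ((3 : ℕ) : 𝓞 ℚ) ∈ v.asIdeal → A.HasGoodOrdinaryReductionAt v)
    {a₃ b₃ : ℤ} (hL3 : A.HasGoodEulerFactorAt 3 ((lPolynomialOfSurface 3 a₃ b₃).map (Int.castRingHom ℚ)))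
    (hsepL : ((lPolynomialOfSurface 3 a₃ b₃).map (Int.castRingHom ℚ)).Separable) :
    ∀ (p : ℕ) [Fact p.Prime] (b : Module.Basis (Fin 4) ℚ_[p] (A.rationalTateModule p))
      (r : FramedGaloisRep ℚ (PadicAlgCl p) 4),
      (∀ g : absoluteGaloisGroup ℚ,
        (r g).val =
          ((LinearMap.toMatrix b b (A.rationalTateRep p g⁻¹)).map
            (algebraMap ℚ_[p] (PadicAlgCl p))).transpose) →
      ∀ (hcpt : isCompact_glFiniteIntegralLevel 4 ℚ) (ι : PadicAlgCl p ≃+* ℂ),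
        IsAutomorphicAE ι hcpt r := by
  intro p _ b r hr hcpt ι
  obtain ⟨e₃, he₃⟩ := hframe
  have hframe' : ∀ (σ : absoluteGaloisGroup ℚ) (P : A.geomTorsion (3 : ℕ)),
      e₃ (σ • P) = ((FramedRep.dual ρb σ : GL (Fin 4) (ZMod 3)) :
        Matrix (Fin 4) (Fin 4) (ZMod 3)) *ᵥ e₃ P := by
    intro σ P
    rw [he₃, FramedRep.coe_dual_apply, map_inv]
  exact h111 A hA (FramedRep.dual ρb) e₃ ρb hframe' (FramedRep.dual_dual ρb) hsurj
    (fun v hv => ⟨hunr v hv, frobCharpoly_two_ne_of_eulerData hA ⟨e₃, he₃⟩ hL2 hab v hv⟩) hord3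
    (fun ℓ _ hℓ b' r' hr' v hv =>
      separable_dualFrame_of_hasGoodEulerFactorAt hL3
        (coeff_zero_lPolynomialOfSurface_map_ne_zero 3 _ _) hsepL ℓ hℓ b' r' hr' v hv)
    p b r hr hcpt ι

end Summit.Ventures.ResidMod

end
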